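import Summits.AtomisticToContinuum.HydrodynamicLimit.Theorems.LambertianContactSwapContactAngleEquidistributionEqCruxSandwich
import Summits.AtomisticToContinuum.HydrodynamicLimit.Theorems.LambertianContactSwapContactAngleEquidistributionEqCruxTools
import Summits.AtomisticToContinuum.HydrodynamicLimit.Theorems.LambertianContactSwapContactAngleEquidistributionEqFluxMidSum
import Summits.AtomisticToContinuum.HydrodynamicLimit.Theorems.LambertianContactSwapContactAngleEquidistributionEqStaticFlux
import Summits.AtomisticToContinuum.HydrodynamicLimit.Theorems.LambertianContactSwapContactAngleEquidistributionEqDumbbellLimit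
import Summits.AtomisticToContinuum.HydrodynamicLimit.Theorems.LambertianContactSwapContactAngleEquidistributionEqFluxMoment
import HarnessLib

/-!
# The equilibrium crux (stub `stub_eqCrux`, line `Sketch` v5, crux
# `LambertianContactSwap.ContactAngleEquidistribution`, stmt-AtomisticToContinuum-12097; lead c2)

WHAT. `stub_eqCrux` = `eq_contactAngleEquidistribution`: conditional on the named fact
`HardSphereCampbellFormula` (CIP 1994 App. 4.A), for every `θ > 0` there is `σ₀ > 0` such that for
`0 < σ < σ₀`, every family of hard-sphere flow structures `Φ`, every `t ≥ 0` and EVERY admissible test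
function `ψ_N(s, x, v, v_*, n)` (jointly measurable, `|ψ_N| ≤ 1`), the mean under the homogeneous Gibbs law
`Q_N = localGibbsLaw σ 1 0 θ N (Φ N)` of the crux functional — verbatim the body of
`ContactAngleEquidistribution` — tends to `0` as `N → ∞`.

HOW. Positive / negative parts of the centred mark (`stub_eqCruxParts`, integrability from
`stub_nearFieldFinite`); Campbell with time-dependent marks (`stub_campbellTimeDep`); the outgoing flux of a
mark reading only (midpoint, incoming velocities, normal) is `#{i<j} ×` the static functional
(`flux_special_eq` = `stub_eqFluxMidSum` + `stub_eqStaticFlux`); the static sandwich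
(`stub_eqCruxSandwich`, fed by `stub_eqDumbbellLimit` and `stub_eqFluxMoment`) bounds the difference of
the two time integrals by `#{i<j} · 4δ ε_N² K t`, and `(N+1)^{-4/3} #{i<j} ε_N² ≤ σ²`
(`rpow_mul_sq_mul_hsDiameter_sq`); `δ → 0`.

References: Cercignani–Illner–Pulvirenti (1994) App. 4.A; Ruelle (1969) §4.2; Pulvirenti–Tsagkarogiannis (2012).
-/

noncomputable section

open MeasureTheory Filter Set Topology ProbabilityTheory
open scoped ENNReal BigOperators Classical RealInnerProductSpace

namespace Summit.AtomisticToContinuum.HydrodynamicLimit.Theorems.ContactAngleEquidistributionSketch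

open Literature.Analysis.FluidPDE Literature.MathematicalPhysics.KineticTheory

namespace EqCrux

/-! ### The flux of a mark reading only (midpoint, incoming velocities, normal) -/

/-- **The outgoing flux of a Gibbs-weighted mark `Ψ(x_mid, v_i, v_j, n)` is the pair count times the
static functional** (`stub_eqFluxMidSum` + `stub_eqStaticFlux`). [cite: CIP1994, App. 4.A pp. 107–111] -/
theorem flux_special_eq {σ : ℝ} (hσ : 0 < σ) (hσh : σ < 1 / 2) {θ : ℝ} (hθ : 0 < θ) (N : ℕ)
    (Ψ : T3 → V3 → V3 → V3 → ℝ≥0∞)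
    (hΨ : Measurable fun p : T3 × V3 × V3 × V3 => Ψ p.1 p.2.1 p.2.2.1 p.2.2.2) :
    outgoingCollisionFlux (hsDiameter σ N) (N + 1) (fun w i j =>
        ENNReal.ofReal (canonicalDensity (Torus.geometry (Fin 3)) (hsDiameter σ N) (N + 1)
          (localGibbsProfile (fun _ => 1) (fun _ => 0) (fun _ => θ)) w) *
        (if i < j then
          Ψ ((Torus.geometry (Fin 3)).translate (collidePair (Torus.geometry (Fin 3)) i j w j).1
              ((2 : ℝ)⁻¹ • (Torus.geometry (Fin 3)).sepVec (collidePair (Torus.geometry (Fin 3)) i j w i).1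
                (collidePair (Torus.geometry (Fin 3)) i j w j).1))
            (collidePair (Torus.geometry (Fin 3)) i j w i).2 (collidePair (Torus.geometry (Fin 3)) i j w j).2
            ((hsDiameter σ N)⁻¹ • (Torus.geometry (Fin 3)).sepVec (collidePair (Torus.geometry (Fin 3)) i j w i).1
              (collidePair (Torus.geometry (Fin 3)) i j w j).1)
          else 0)) =
      (∑ i : Fin (N + 1), ∑ j : Fin (N + 1), if i < j then (1 : ℝ≥0∞) else 0) *
        ∫⁻ x : T3, ∫⁻ v : V3, ∫⁻ w : V3, ∫⁻ ω : Metric.sphere (0 : V3) 1,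
          ENNReal.ofReal (hsDiameter σ N ^ (Fintype.card (Fin 3) - 1) * ⟪((ω : V3)), w - v⟫) *
            ENNReal.ofReal (localMaxwellian 1 θ 0 v * localMaxwellian 1 θ 0 w) * Ψ x v w ω *
              ENNReal.ofReal (vcan (hsDiameter σ N) (N + 1)
                ![x + Literature.Analysis.FunctionSpaces.Torus.proj ((hsDiameter σ N / 2) • (ω : V3)),
                  x + Literature.Analysis.FunctionSpaces.Torus.proj (-((hsDiameter σ N / 2) • (ω : V3)))])
          ∂(volume : Measure V3).toSphere := by
  have hF : ∀ i j : Fin (N + 1), Measurable fun y : Config (N + 1) (Fin 3) T3 =>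
      Ψ ((Torus.geometry (Fin 3)).translate (y j).1
          ((2 : ℝ)⁻¹ • (Torus.geometry (Fin 3)).sepVec (y i).1 (y j).1))
        (y i).2 (y j).2 ((hsDiameter σ N)⁻¹ • (Torus.geometry (Fin 3)).sepVec (y i).1 (y j).1) := by
    intro i j
    have hy : Measurable fun y : Config (N + 1) (Fin 3) T3 => y := measurable_id
    have hsep : Measurable fun y : Config (N + 1) (Fin 3) T3 =>
        (hsDiameter σ N)⁻¹ • (Torus.geometry (Fin 3)).sepVec (y i).1 (y j).1 :=
      (measurable_const_smul _).comp (NearField.measurable_sepVec' hy i j)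
    exact hΨ.comp ((NearField.measurable_xmid' hy i j).prodMk ((NearField.measurable_vel' hy i).prodMk
      ((NearField.measurable_vel' hy j).prodMk hsep)))
  rw [← sum_ite_lt_mul]
  convert stub_eqFluxMidSum hσ hσh θ N (fun y i j =>
      Ψ ((Torus.geometry (Fin 3)).translate (y j).1
          ((2 : ℝ)⁻¹ • (Torus.geometry (Fin 3)).sepVec (y i).1 (y j).1))
        (y i).2 (y j).2 ((hsDiameter σ N)⁻¹ • (Torus.geometry (Fin 3)).sepVec (y i).1 (y j).1)) hF using 1
  refine Finset.sum_congr rfl fun i _ => Finset.sum_congr rfl fun j _ => ?_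
  by_cases hlt : i < j
  · rw [if_pos hlt, if_pos hlt]
    exact (stub_eqStaticFlux hσ hσh hθ (ne_of_lt hlt) Ψ hΨ).symm
  · rw [if_neg hlt, if_neg hlt]

end EqCrux

open EqCrux in
/-- **Registered sub-goal `stub_eqCrux` = THE EQUILIBRIUM CRUX** (line `Sketch` v5, crux
ContactAngleEquidistribution, stmt-AtomisticToContinuum-12097). Conditional on the named fact
`HardSphereCampbellFormula`: for every `θ > 0` there is `σ₀ > 0` such that for all `0 < σ < σ₀`, all families
of hard-sphere flow structures `Φ`, all `t ≥ 0` and ALL admissible test functions `ψ_N (s, x, v, v_*, n)`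
(jointly measurable, `|ψ_N| ≤ 1`; no modulus of continuity in `n` is needed), the mean under the homogeneous
Gibbs law `Q_N = localGibbsLaw σ 1 0 θ N (Φ N)` of the crux functional — the normalised `|g|²`-weighted
collision sum of `κ_g`-centred marks over Alexander's construction, VERBATIM the body of
`ContactAngleEquidistribution` — tends to `0` as `N → ∞` (contact-normal equidistribution given the pair
holds at equilibrium at fixed reduced density; the finite-`N` defect is the cubic anisotropy of the contact
dumbbell correlation on `𝕋³`, killed by the canonical Kirkwood–Salsburg limit).
[cite: CIP1994, App. 4.A pp. 107–111; Ruelle1969, §4.2.3 Thm 4.2.3] -/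
theorem stub_eqCrux (hC : HardSphereCampbellFormula) :
    let Cfg : ℕ → Type := fun N => Config (N + 1) (Fin 3) T3
    let G := Torus.geometry (Fin 3)
    let ε : ℝ → ℕ → ℝ := hsDiameter
    let τ : ℝ → (N : ℕ) → Cfg N → ℝ≥0∞ := fun σ N z => Alexander.freeExitTime G (ε σ N) z
    let S : ℝ → (N : ℕ) → Cfg N → Cfg N := fun t _ z => freeFlight G t z
    let ldir : V3 → V3 → V3 := fun ω ξ => ‖‖ω‖⁻¹ • ω + ‖ξ‖⁻¹ • ξ‖⁻¹ • (‖ω‖⁻¹ • ω + ‖ξ‖⁻¹ • ξ)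
    let zpre : ℝ → (N : ℕ) → Cfg N → ℕ → Cfg N := fun σ N z m =>
      let y := Alexander.stateAfter G (ε σ N) z m; S (τ σ N y).toReal N y
    let Kt : ℝ → (N : ℕ) → Cfg N → ℝ → ℕ := fun σ N z t => Alexander.collisionCount G (ε σ N) z t
    let hit : ℝ → (N : ℕ) → Cfg N → Fin (N + 1) → Fin (N + 1) → Prop := fun σ N y i j =>
      i < j ∧ y ∈ contactSet G (N + 1) (ε σ N) i j ∧ IsIncoming G y i j
    let tcol : ℝ → (N : ℕ) → Cfg N → ℕ → ℝ := fun σ N z m =>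
      (Alexander.collisionInstant G (ε σ N) z (m + 1)).toReal
    let xmid : (N : ℕ) → Cfg N → Fin (N + 1) → Fin (N + 1) → T3 := fun _ y i j =>
      G.translate (y j).1 ((2 : ℝ)⁻¹ • G.sepVec (y i).1 (y j).1)
    ∀ θ : ℝ, 0 < θ → ∃ σ₀ : ℝ, 0 < σ₀ ∧ ∀ σ : ℝ, 0 < σ → σ < σ₀ →
      ∀ Φ : (N : ℕ) → HardSphereFlow G (ε σ N) (N + 1),
      let Q := fun N => localGibbsLaw σ (fun _ => 1) (fun _ => 0) (fun _ => θ) N (Φ N)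
      ∀ t : ℝ, 0 ≤ t → ∀ ψ : ℕ → ℝ → T3 → V3 → V3 → V3 → ℝ,
        (∀ N, Measurable (fun p : ℝ × T3 × V3 × V3 × V3 =>
          ψ N p.1 p.2.1 p.2.2.1 p.2.2.2.1 p.2.2.2.2)) →
        (∀ N s x v w n, |ψ N s x v w n| ≤ 1) →
        Tendsto (fun N : ℕ => ∫ z, ((N : ℝ) + 1) ^ (-(4 / 3 : ℝ)) *
          ∑ m ∈ Finset.range (Kt σ N z t), ∑ i : Fin (N + 1), ∑ j : Fin (N + 1),
            (let y := zpre σ N z m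
             if hit σ N y i j then
               ‖(y i).2 - (y j).2‖ ^ 2 *
                 (ψ N (tcol σ N z m) (xmid N y i j) (y i).2 (y j).2 ((ε σ N)⁻¹ • G.sepVec (y i).1 (y j).1) -
                   ∫ ξ, ψ N (tcol σ N z m) (xmid N y i j) (y i).2 (y j).2 (ldir (-((y i).2 - (y j).2)) ξ)
                     ∂(stdGaussian V3))
             else 0) ∂(Q N)) atTop (𝓝 0) := by
  intro Cfg G ε τ S ldir zpre Kt hit tcol xmid θ hθ
  have hW := stub_campbellTimeDep hC
  have hfin := stub_nearFieldFinite
  have hM := stub_meas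
  dsimp (config := { zeta := true }) only at hW hfin hM
  obtain ⟨σ₁, hσ₁, hW⟩ := hW θ hθ
  obtain ⟨σ₂, hσ₂, hfin⟩ := hfin (fun _ => 1) (fun _ => θ) (fun _ => 0) continuous_const
    continuous_const continuous_const (fun _ => one_pos) (fun _ => hθ)
  obtain ⟨σ₃, hσ₃, hsd⟩ := exists_smallDensity uniformProfile one_pos
  obtain ⟨K, hK⟩ := stub_eqFluxMoment hθ
  refine ⟨min (min σ₁ σ₂) (min σ₃ (1 / 2)), lt_min (lt_min hσ₁ hσ₂) (lt_min hσ₃ (by norm_num)),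
    fun σ hσ hσlt Φ => ?_⟩
  intro Q t ht ψ hψm hψb
  have hσ1 : σ < σ₁ := lt_of_lt_of_le hσlt ((min_le_left _ _).trans (min_le_left _ _))
  have hσ2' : σ < σ₂ := lt_of_lt_of_le hσlt ((min_le_left _ _).trans (min_le_right _ _))
  have hσ3 : σ < σ₃ := lt_of_lt_of_le hσlt ((min_le_right _ _).trans (min_le_left _ _))
  have hσh : σ < 1 / 2 := lt_of_lt_of_le hσlt ((min_le_right _ _).trans (min_le_right _ _))
  have hσ2 : σ < 2⁻¹ := by rw [← one_div]; exact hσh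
  obtain ⟨g₀, hg₀, hlim⟩ := stub_eqDumbbellLimit (hsd σ hσ hσ3).1
  -- a nonnegative moment constant
  set K' : ℝ := max K 0 with hK'def
  have hK'0 : 0 ≤ K' := le_max_right _ _
  have hK' := hK.trans (ENNReal.ofReal_le_ofReal (le_max_left K 0))
  rw [Metric.tendsto_atTop]
  intro η hη
  set A : ℝ := 4 * K' * t * σ ^ 2 with hAdef
  have hA0 : 0 ≤ A := by positivity
  obtain ⟨δ, hδ, hδA⟩ : ∃ δ : ℝ, 0 < δ ∧ δ * A < η := by
    refine ⟨η / (A + 1), div_pos hη (by linarith), ?_⟩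
    rw [div_mul_eq_mul_div, div_lt_iff₀ (by linarith)]
    nlinarith
  obtain ⟨N₀, hN₀⟩ := eventually_atTop.1 (hlim δ hδ)
  refine ⟨N₀, fun N hN => ?_⟩
  rw [Real.dist_0_eq_abs]
  have hVN := hN₀ N hN
  /- constants of level `N` -/
  have hc : (0 : ℝ) < ((N : ℝ) + 1) ^ (-(4 / 3 : ℝ)) := Real.rpow_pos_of_pos (by positivity) _
  set P : ℝ≥0∞ := ∑ i : Fin (N + 1), ∑ j : Fin (N + 1), if i < j then (1 : ℝ≥0∞) else 0 with hPdef
  have hPle : P ≤ ((N + 1 : ℕ) : ℝ≥0∞) * (N + 1 : ℕ) := sum_ite_lt_le (N + 1)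
  have hPtop : P ≠ ⊤ :=
    ne_top_of_le_ne_top (ENNReal.mul_ne_top (ENNReal.natCast_ne_top _) (ENNReal.natCast_ne_top _)) hPle
  have hPreal : P.toReal ≤ ((N + 1 : ℕ) : ℝ) ^ 2 := by
    have h := ENNReal.toReal_mono (ENNReal.mul_ne_top (ENNReal.natCast_ne_top _)
      (ENNReal.natCast_ne_top _)) hPle
    rw [ENNReal.toReal_mul, ENNReal.toReal_natCast] at h
    rw [sq]
    exact h
  have hεk : hsDiameter σ N ^ (Fintype.card (Fin 3) - 1) = hsDiameter σ N ^ 2 := by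
    rw [Fintype.card_fin]
  have hεk0 : 0 ≤ hsDiameter σ N ^ (Fintype.card (Fin 3) - 1) := pow_nonneg (hsDiameter_pos hσ N).le _
  have hnorm : ((N : ℝ) + 1) ^ (-(4 / 3 : ℝ)) * P.toReal * hsDiameter σ N ^ (Fintype.card (Fin 3) - 1) ≤
      σ ^ 2 := by
    rw [hεk, ← LambertianContactSwapCollisionMomentBound.rpow_mul_sq_mul_hsDiameter_sq σ N]
    refine mul_le_mul_of_nonneg_right (mul_le_mul_of_nonneg_left hPreal hc.le) (sq_nonneg _)
  /- the centred mark, its parts, measurability and bounds -/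
  set MR : ℝ → Cfg N → Fin (N + 1) → Fin (N + 1) → ℝ := fun s y i j =>
    ‖(y i).2 - (y j).2‖ ^ 2 * (ψ N s (xmid N y i j) (y i).2 (y j).2 ((ε σ N)⁻¹ • G.sepVec (y i).1 (y j).1) -
      ∫ ξ, ψ N s (xmid N y i j) (y i).2 (y j).2 (ldir (-((y i).2 - (y j).2)) ξ) ∂(stdGaussian V3)) with hMRdef
  have hMRj : ∀ i j : Fin (N + 1), Measurable fun p : ℝ × Cfg N => MR p.1 p.2 i j := by
    intro i j
    have hy : Measurable fun p : ℝ × Cfg N => p.2 := measurable_snd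
    have hvi := NearField.measurable_vel' hy i
    have hvj := NearField.measurable_vel' hy j
    have hxm := NearField.measurable_xmid' hy i j
    have hsp : Measurable fun p : ℝ × Cfg N => (ε σ N)⁻¹ • G.sepVec (p.2 i).1 (p.2 j).1 :=
      (measurable_const_smul _).comp (NearField.measurable_sepVec' hy i j)
    have h1 := NearField.measurable_psiAt (hψm N) measurable_fst hxm hvi hvj hsp
    have h2 := NearField.measurable_cosineMean (hψm N) measurable_fst hxm hvi hvj (hvi.sub hvj)
    exact ((hvi.sub hvj).norm.pow_const 2).mul (h1.sub h2)
  have hMRb : ∀ s (y : Cfg N) i j, |MR s y i j| ≤ 2 * ‖(y i).2 - (y j).2‖ ^ 2 := by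
    intro s y i j
    rw [hMRdef]
    dsimp only
    rw [abs_mul, abs_pow, abs_norm, mul_comm 2]
    refine mul_le_mul_of_nonneg_left ?_ (sq_nonneg _)
    have h1 := hψb N s (xmid N y i j) (y i).2 (y j).2 ((ε σ N)⁻¹ • G.sepVec (y i).1 (y j).1)
    have h2 := NearField.abs_integral_le_one (stdGaussian V3)
      (f := fun ξ => ψ N s (xmid N y i j) (y i).2 (y j).2 (ldir (-((y i).2 - (y j).2)) ξ))
      fun ξ => hψb N s _ _ _ _
    exact (abs_sub _ _).trans (by linarith)
  have hpm : ∀ c' : ℝ, ∀ i j : Fin (N + 1), Measurable fun p : ℝ × Cfg N => max (c' * MR p.1 p.2 i j) 0 :=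
    fun c' i j => (measurable_const.mul (hMRj i j)).max measurable_const
  -- the static functionals of the two parts
  set Stat : ℝ → ℝ → ℝ≥0∞ := fun c' s =>
      ∫⁻ x : T3, ∫⁻ v : V3, ∫⁻ w : V3, ∫⁻ ω : Metric.sphere (0 : V3) 1,
        ENNReal.ofReal (hsDiameter σ N ^ (Fintype.card (Fin 3) - 1) * ⟪((ω : V3)), w - v⟫) *
          ENNReal.ofReal (localMaxwellian 1 θ 0 v * localMaxwellian 1 θ 0 w) *
          ENNReal.ofReal (max (c' * (‖v - w‖ ^ 2 * (ψ N s x v w ω -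
            ∫ ξ, ψ N s x v w (ldir (-(v - w)) ξ) ∂(stdGaussian V3)))) 0) *
          ENNReal.ofReal (vcan (hsDiameter σ N) (N + 1)
            ![x + Literature.Analysis.FunctionSpaces.Torus.proj ((hsDiameter σ N / 2) • (ω : V3)),
              x + Literature.Analysis.FunctionSpaces.Torus.proj (-((hsDiameter σ N / 2) • (ω : V3)))])
        ∂(volume : Measure V3).toSphere with hStatdef
  -- Campbell + midpoint flux + spectator integration: the mean of each part is a time integral of `P * Stat`
  have e : ∀ c' : ℝ,
      ∫⁻ z, ENNReal.ofReal (∑ m ∈ Finset.range (Kt σ N z t), ∑ i : Fin (N + 1), ∑ j : Fin (N + 1),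
          (if hit σ N (zpre σ N z m) i j then max (c' * MR (tcol σ N z m) (zpre σ N z m) i j) 0 else 0))
        ∂(Q N) = ∫⁻ s in Ioc 0 t, P * Stat c' s := by
    intro c'
    have step1 : ∫⁻ z, ENNReal.ofReal (∑ m ∈ Finset.range (Kt σ N z t), ∑ i : Fin (N + 1),
        ∑ j : Fin (N + 1),
          (if hit σ N (zpre σ N z m) i j then max (c' * MR (tcol σ N z m) (zpre σ N z m) i j) 0 else 0))
        ∂(Q N) =
        ∫⁻ z, (∑ m ∈ Finset.range (Kt σ N z t), ∑ i : Fin (N + 1), ∑ j : Fin (N + 1),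
          (if hit σ N (zpre σ N z m) i j then
            ENNReal.ofReal (max (c' * MR (tcol σ N z m) (zpre σ N z m) i j) 0) else 0)) ∂(Q N) :=
      lintegral_congr fun z => EqCentring.ofReal_sum3 _ _ _ _ (fun m i j => by positivity)
        fun m i j => ofReal_ite _
    have step2 := hW σ hσ hσ1 Φ t ht N (fun s y i j => ENNReal.ofReal (max (c' * MR s y i j) 0))
      fun i j => (hpm c' i j).ennreal_ofReal
    have step3 : ∀ s : ℝ, _ = P * Stat c' s := fun s =>
      flux_special_eq hσ hσh hθ N (fun x v w n => ENNReal.ofReal (max (c' * (‖v - w‖ ^ 2 *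
        (ψ N s x v w n - ∫ ξ, ψ N s x v w (ldir (-(v - w)) ξ) ∂(stdGaussian V3)))) 0))
        (measurable_markPartV (hψm N) s c')
    exact step1.trans (step2.trans (lintegral_congr step3))
  -- the static sandwich, integrated in time
  have hCst0 : 0 ≤ 4 * δ * hsDiameter σ N ^ (Fintype.card (Fin 3) - 1) * K' := by positivity
  have hI : ∀ c₁ c₂ : ℝ, (∀ s : ℝ, Stat c₁ s ≤ Stat c₂ s +
        ENNReal.ofReal (4 * δ * hsDiameter σ N ^ (Fintype.card (Fin 3) - 1) * K')) →
      ∫⁻ s in Ioc 0 t, P * Stat c₁ s ≤ (∫⁻ s in Ioc 0 t, P * Stat c₂ s) +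
        P * ENNReal.ofReal (4 * δ * hsDiameter σ N ^ (Fintype.card (Fin 3) - 1) * K') * ENNReal.ofReal t := by
    intro c₁ c₂ h
    calc ∫⁻ s in Ioc 0 t, P * Stat c₁ s
        ≤ ∫⁻ s in Ioc 0 t, (P * Stat c₂ s +
            P * ENNReal.ofReal (4 * δ * hsDiameter σ N ^ (Fintype.card (Fin 3) - 1) * K')) :=
          lintegral_mono fun s => by rw [← mul_add]; exact mul_le_mul' le_rfl (h s)
      _ = (∫⁻ s in Ioc 0 t, P * Stat c₂ s) +
            ∫⁻ _s in Ioc 0 t, P * ENNReal.ofReal (4 * δ * hsDiameter σ N ^ (Fintype.card (Fin 3) - 1) * K') :=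
          lintegral_add_right _ measurable_const
      _ = _ := by rw [setLIntegral_const, Real.volume_Ioc, sub_zero, mul_assoc]
  have hItop : ∀ c' : ℝ, (∀ s : ℝ, Stat c' s ≤
        ENNReal.ofReal ((g₀ + δ) * (2 * hsDiameter σ N ^ (Fintype.card (Fin 3) - 1) * K'))) →
      ∫⁻ s in Ioc 0 t, P * Stat c' s ≠ ⊤ := by
    intro c' h
    refine ne_top_of_le_ne_top ?_ (lintegral_mono fun s => mul_le_mul' (le_refl P) (h s))
    rw [setLIntegral_const, Real.volume_Ioc, sub_zero]
    exact ENNReal.mul_ne_top (ENNReal.mul_ne_top hPtop ENNReal.ofReal_ne_top) ENNReal.ofReal_ne_top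
  have S : ∀ s : ℝ, (Stat 1 s ≤ Stat (-1) s +
        ENNReal.ofReal (4 * δ * hsDiameter σ N ^ (Fintype.card (Fin 3) - 1) * K')) ∧
      (Stat (-1) s ≤ Stat 1 s +
        ENNReal.ofReal (4 * δ * hsDiameter σ N ^ (Fintype.card (Fin 3) - 1) * K')) ∧
      (Stat 1 s ≤ ENNReal.ofReal ((g₀ + δ) * (2 * hsDiameter σ N ^ (Fintype.card (Fin 3) - 1) * K'))) ∧
      (Stat (-1) s ≤ ENNReal.ofReal ((g₀ + δ) * (2 * hsDiameter σ N ^ (Fintype.card (Fin 3) - 1) * K'))) := by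
    intro s
    have S' := stub_eqCruxSandwich hσ θ N ψ hψm hψb s hg₀ hδ.le hVN hK'
    dsimp only at S'
    exact S'
  have hdiff : |(∫⁻ s in Ioc 0 t, P * Stat 1 s).toReal - (∫⁻ s in Ioc 0 t, P * Stat (-1) s).toReal| ≤
      (P * ENNReal.ofReal (4 * δ * hsDiameter σ N ^ (Fintype.card (Fin 3) - 1) * K') * ENNReal.ofReal t).toReal :=
    abs_toReal_sub_le (hI 1 (-1) fun s => (S s).1) (hI (-1) 1 fun s => (S s).2.1)
      (hItop 1 fun s => (S s).2.2.1) (hItop (-1) fun s => (S s).2.2.2)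
      (ENNReal.mul_ne_top (ENNReal.mul_ne_top hPtop ENNReal.ofReal_ne_top) ENNReal.ofReal_ne_top)
  /- `|E_N| ≤ (N+1)^{-4/3} · P · 4δ ε² K' t ≤ δ A < η` -/
  have hWm : Measurable fun z : Cfg N => ((N : ℝ) + 1) ^ (-(4 / 3 : ℝ)) *
      ∑ m ∈ Finset.range (Kt σ N z t), ∑ i : Fin (N + 1), ∑ j : Fin (N + 1),
        (if hit σ N (zpre σ N z m) i j then 1 + ‖(zpre σ N z m i).2 - (zpre σ N z m j).2‖ ^ 3 else 0) :=
    (hM σ hσ hσ2 N t (fun _ y i j => 1 + ‖(y i).2 - (y j).2‖ ^ 3) fun i j =>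
      measurable_const.add (((NearField.measurable_vel' measurable_snd i).sub
        (NearField.measurable_vel' measurable_snd j)).norm.pow_const 3)).const_mul _
  have PARTS : |∫ z, (∑ m ∈ Finset.range (Kt σ N z t), ∑ i : Fin (N + 1), ∑ j : Fin (N + 1),
      (if hit σ N (zpre σ N z m) i j then MR (tcol σ N z m) (zpre σ N z m) i j else 0)) ∂(Q N)| ≤
      (P * ENNReal.ofReal (4 * δ * hsDiameter σ N ^ (Fintype.card (Fin 3) - 1) * K') * ENNReal.ofReal t).toReal := by
    refine stub_eqCruxParts (hfin σ hσ hσ2' Φ t ht N)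
      (hM σ hσ hσ2 N t (fun s y i j => max (1 * MR s y i j) 0) (hpm 1))
      (hM σ hσ hσ2 N t (fun s y i j => max (-1 * MR s y i j) 0) (hpm (-1))) hWm (2 / ((N : ℝ) + 1) ^ (-(4 / 3 : ℝ))) (fun z => ?_) (fun z => ?_)
      (fun z => ?_) (fun z => ?_) (fun z => ?_) (fun z => ?_) ?_
    · exact mul_nonneg hc.le (EqCentring.sum3_nonneg _ _ _ fun m i j => by positivity)
    · rw [← mul_assoc, div_mul_cancel₀ _ hc.ne']
      exact EqCentring.abs_sum3_le _ _ 2 _ _ fun m i j =>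
        abs_ite_part_le abs_one (norm_nonneg _) (hMRb _ _ i j)
    · rw [← mul_assoc, div_mul_cancel₀ _ hc.ne']
      exact EqCentring.abs_sum3_le _ _ 2 _ _ fun m i j =>
        abs_ite_part_le (by norm_num) (norm_nonneg _) (hMRb _ _ i j)
    · exact EqCentring.sum3_nonneg _ _ _ fun m i j => by positivity
    · exact EqCentring.sum3_nonneg _ _ _ fun m i j => by positivity
    · exact EqCentring.sum3_eq_sub _ _ _ _ _ fun m i j => by
        rw [one_mul, neg_one_mul]; exact EqCentring.ite_eq_sub _
    · rw [e 1, e (-1)]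
      exact hdiff
  rw [integral_const_mul, abs_mul, abs_of_pos hc]
  calc ((N : ℝ) + 1) ^ (-(4 / 3 : ℝ)) * |∫ z, (∑ m ∈ Finset.range (Kt σ N z t), ∑ i : Fin (N + 1),
        ∑ j : Fin (N + 1),
          (if hit σ N (zpre σ N z m) i j then MR (tcol σ N z m) (zpre σ N z m) i j else 0)) ∂(Q N)|
      ≤ ((N : ℝ) + 1) ^ (-(4 / 3 : ℝ)) *
          (P * ENNReal.ofReal (4 * δ * hsDiameter σ N ^ (Fintype.card (Fin 3) - 1) * K') *
            ENNReal.ofReal t).toReal := mul_le_mul_of_nonneg_left PARTS hc.le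
    _ = δ * (4 * K' * t) * (((N : ℝ) + 1) ^ (-(4 / 3 : ℝ)) * P.toReal *
          hsDiameter σ N ^ (Fintype.card (Fin 3) - 1)) := by
        rw [ENNReal.toReal_mul, ENNReal.toReal_mul, ENNReal.toReal_ofReal hCst0, ENNReal.toReal_ofReal ht]
        ring
    _ ≤ δ * (4 * K' * t) * σ ^ 2 := mul_le_mul_of_nonneg_left hnorm (by positivity)
    _ = δ * A := by rw [hAdef]; ring
    _ < η := hδA

end Summit.AtomisticToContinuum.HydrodynamicLimit.Theorems.ContactAngleEquidistributionSketch

end
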